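import Summits.HubbardSuperconductivity.HubbardLadder.HubbardTwoPoleBound
import Summits.HubbardSuperconductivity.HubbardLadder.HubbardTwoPoleCertificate
import HarnessLib

/-!
# The two-pole (`2 × 2`) semidefinite certificate, III: the closed-form doped bound on the torus

HONEST FRAMING (page 1): ladder R1–R4 with certified numbers; no claim on H/H₀; first certified
bounds; not a superconductivity verdict. A SOUNDNESS EDGE of the pub-hubbard cell (seat `pseudo` g64,
`PSEUDO.md` §110 / `TO-ENG.md` §C 130; staged, NOT filed — the FILER decision is the desk's): the
certificate-form two-pole bound `hubbardTorus_groundEnergyAt_ge_twoPole` (pseudo g63; filed split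
`HubbardTwoPoleFrame` + `HubbardTwoPoleBound`, lit g33) combined with the closed-form optimal certificate
`exists_twoPole_certificate` (part II, `HubbardTwoPoleCertificate`) gives, on the torus `(ℤ/Lℤ)^d`,
`L ≥ 3`, any real `t, U`, any `μ_σ, λ_σ ∈ ℝ` and any filling `0 < n < L^d` (`ρ = n/L^d ∈ (0, 1)`):

`E_L(2n) ≥ Σ_σ (Σ_k certValue (ε_k + μ_σ) (λ_σ/2) (U/2 - λ_σ) ρ - μ_σ n)`,  `ε_k = -siteBand t k`,

where `certValue a b d ρ = min 0 e₊ + min 0 e₋` is the sum of the negative eigenvalues of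
`!![a, b; b, d] · !![1, ρ; ρ, ρ]` (`HubbardTwoPolePencil`). By `twoPole_certificate_optimal` this is the
best bound the certificate form can give for fixed `μ, λ` (the supremum over the `T_{σ,k}` is attained
termwise). This is the statement a number would instantiate (choose rational `μ_σ, λ_σ`; `siteBand` is
rational at `L ∈ {3, 4, 6}` and quadratic at `L ∈ {8, 12}`); no number is claimed here.
[cite: LangerMattis1971, eq. (5)][cite: LiebLoss1993, §8 Theorem 8.2][folklore] (2 × 2 semidefinite
duality). All statements are PROVED (no placeholders, no named facts); no new axioms, no instances, no notation.
-/

noncomputable section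

namespace Summit.HubbardSuperconductivity.HubbardLadder

open Matrix Finset Literature.MathematicalPhysics.QuantumLattice
  Literature.MathematicalPhysics.QuantumLattice.LangerMattis
  Literature.MathematicalPhysics.QuantumLattice.RayleighBound
  Literature.Probability.LatticeModels TwoPoleCertificate
open scoped ComplexOrder ComplexConjugate

variable {d L : ℕ} [NeZero L]

/-- **The closed-form two-pole bound on the Hubbard torus** `(ℤ/Lℤ)^d`, `L ≥ 3`, any real `t, U`,
`0 < n < L^d`, `ρ = n/L^d`: for all `μ_σ, λ_σ ∈ ℝ`,
`E_L(2n) ≥ Σ_σ (Σ_k certValue (-siteBand t k + μ_σ) (λ_σ/2) (U/2 - λ_σ) ρ - μ_σ n)` — the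
certificate-form bound `hubbardTorus_groundEnergyAt_ge_twoPole` with every `T_{σ,k}` chosen optimally by
`exists_twoPole_certificate`.
[cite: LangerMattis1971, eq. (5)][cite: LiebLoss1993, §8 Theorem 8.2][folklore] -/
theorem hubbardTorus_groundEnergyAt_ge_twoPole_closedForm (hL : 3 ≤ L) (t U : ℝ) (μ lam : Fin 2 → ℝ)
    {n : ℕ} (hn0 : 0 < n) (hn : n < L ^ d) :
    ∑ σ : Fin 2, ((∑ k : FermionTorus d L,
        certValue (-(siteBand t k) + μ σ) (lam σ / 2) (U / 2 - lam σ) ((n : ℝ) / (L : ℝ) ^ d)) -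
        μ σ * n) ≤
      groundEnergyAt (fermionTorusGraph d L) t U (2 * n) := by
  classical
  have hL0 : (0 : ℝ) < (L : ℝ) := by exact_mod_cast Nat.pos_of_ne_zero (NeZero.ne L)
  have hLd : (0 : ℝ) < (L : ℝ) ^ d := pow_pos hL0 d
  have h0 : (0 : ℝ) < (n : ℝ) / (L : ℝ) ^ d := div_pos (by exact_mod_cast hn0) hLd
  have h1 : (n : ℝ) / (L : ℝ) ^ d < 1 := by
    rw [div_lt_one hLd]
    exact_mod_cast hn
  -- the optimal certificates, mode by mode
  choose T hT hCT hval using fun (σ : Fin 2) (k : FermionTorus d L) =>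
    exists_twoPole_certificate U (-(siteBand t k)) (μ σ) (lam σ) h0 h1
  have h := hubbardTorus_groundEnergyAt_ge_twoPole hL t U μ lam T hT hCT hn.le
  refine le_trans (le_of_eq ?_) h
  simp only [twoPoleGram, hval, Finset.sum_neg_distrib]
  rw [← Finset.sum_neg_distrib]
  exact Finset.sum_congr rfl fun σ _ => by ring

/-- **Termwise optimality of the closed form** (fixed `μ, λ`): no admissible certificate family beats it —
for every `T_{σ,k} ⪰ 0` with `C_{σ,k} + T_{σ,k} ⪰ 0` the certificate-form value is at most the
closed-form value. [folklore] -/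
theorem twoPole_certificateForm_le_closedForm (t U : ℝ) (μ lam : Fin 2 → ℝ)
    (T : Fin 2 → FermionTorus d L → Matrix (Fin 2) (Fin 2) ℂ) (hT : ∀ σ k, (T σ k).PosSemidef)
    (hCT : ∀ σ k, (twoPoleCost U (-(siteBand t k)) (μ σ) (lam σ) + T σ k).PosSemidef)
    {n : ℕ} (hn0 : 0 < n) (hn : n < L ^ d) :
    -(∑ σ : Fin 2, ((∑ k, ((T σ k * twoPoleGram ((n : ℝ) / (L : ℝ) ^ d)).trace).re) + μ σ * n)) ≤
      ∑ σ : Fin 2, ((∑ k : FermionTorus d L,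
        certValue (-(siteBand t k) + μ σ) (lam σ / 2) (U / 2 - lam σ) ((n : ℝ) / (L : ℝ) ^ d)) -
        μ σ * n) := by
  classical
  have hL0 : (0 : ℝ) < (L : ℝ) := by exact_mod_cast Nat.pos_of_ne_zero (NeZero.ne L)
  have hLd : (0 : ℝ) < (L : ℝ) ^ d := pow_pos hL0 d
  have h0 : (0 : ℝ) < (n : ℝ) / (L : ℝ) ^ d := div_pos (by exact_mod_cast hn0) hLd
  have h1 : (n : ℝ) / (L : ℝ) ^ d < 1 := by
    rw [div_lt_one hLd]
    exact_mod_cast hn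
  have hk : ∀ σ k, -certValue (-(siteBand t k) + μ σ) (lam σ / 2) (U / 2 - lam σ) ((n : ℝ) / (L : ℝ) ^ d) ≤
      ((T σ k * twoPoleGram ((n : ℝ) / (L : ℝ) ^ d)).trace).re := fun σ k =>
    twoPole_certificate_optimal U (-(siteBand t k)) (μ σ) (lam σ) h0 h1 (hT σ k) (hCT σ k)
  have hσ : ∀ σ : Fin 2, (∑ k : FermionTorus d L,
      certValue (-(siteBand t k) + μ σ) (lam σ / 2) (U / 2 - lam σ) ((n : ℝ) / (L : ℝ) ^ d)) - μ σ * n ≥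
      -(((∑ k, ((T σ k * twoPoleGram ((n : ℝ) / (L : ℝ) ^ d)).trace).re) + μ σ * n)) := fun σ => by
    have := Finset.sum_le_sum fun k (_ : k ∈ (Finset.univ : Finset (FermionTorus d L))) => hk σ k
    rw [Finset.sum_neg_distrib] at this
    linarith
  have := Finset.sum_le_sum fun σ (_ : σ ∈ (Finset.univ : Finset (Fin 2))) => hσ σ
  rw [← Finset.sum_neg_distrib]
  exact this

end Summit.HubbardSuperconductivity.HubbardLadder
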